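import Summits.PneNP.PneNP.Theorems.ChebyshevTracialDesignHSymmetricAmplitudeOne
import HarnessLib

/-!
# Cell pnp-psdrank, route `ChebyshevTracialDesign`: (CG_1′) for `H`-symmetric masks in its LITERAL form — positive parts over the matchings, arbitrary
# (not necessarily pair-symmetric) direction fields — brick 145p (crux `TracialDecayExp20`, stmt-PneNP-19878)

Brick 145p (prover g29; MEMO-32 §8). MEMO-21 §3(c′) states (CG_1′) as «`Σ_M sup_{|v_M|≤1} (Σ_U W(U,M) f(U)·(Σ_p v_M(p) x_p x_{π_M p})²)₊` is `e^{−aD}`-small»,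
and brick 102 §3/§5 (`containment_signCoherent_decay`) proved the sign-coherent case in exactly the shape `Σ_M max (…) 0 ≤ …`. Brick 145
(`allDirections_designValue_le`) is stated for pair-symmetric fields without the positive part. The two shapes are equivalent: the containment form
only sees the pair-symmetrisation `(v_p + v_{πp})/2` of a direction (`…HSymmetricAmplitudeOne.containment_pairSymm`), and the positive part at `M` is the
value at the field `c_M := [Q_M(v_M) ≥ 0]·sym(v_M)` (the zero direction has value `0`). Hence:
* **`containment_allDirections_decay`**: for some `a > 0` and all large even `n`, every balanced exact design of the crux's shape, every balanced block
  `2|H| = n`, every `0 ≤ ψ ≤ G` and EVERY field `v : PM_n → [n] → [−1,1]`: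
  `Σ_M max (Σ_U W(U,M)·ψ(|U∩H|)·(Σ_p v_M(p) x_p x_{π_M p})²) 0 ≤ 7·10⁶·G·n⁶·(e^{−a·dq n} + 2^{−⌊n/40⌋})`.
WHAT THIS FILE DOES NOT DO: non-symmetric masks; anything on `TracialDecayExp20` itself, psd rank of P_PM(K_n), or P vs NP.
[cite: Rothvoss2017, §2 and Lemma 7 (PDF pp. 5–8)] [cite: KeevashLifshitz2023, Thm. 1.8] [cite: GriblingDelaatLaurent2019, §5]
Stature: support/instrument (kernel lane, no defs, axioms standard). Supports stmt-PneNP-19878.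
-/

set_option linter.dupNamespace false -- `Summit.PneNP.PneNP.…`: summit = sub-problem (D-0017)

noncomputable section

namespace Summit.PneNP.PneNP.Theorems.ChebyshevTracialDesignAllDirectionsPosPart

open Finset Literature.Barriers.PneNP Literature.Combinatorics.Optimization
open Summit.PneNP.PneNP.Theorems.ChebyshevTracialDesignAllDirections (allDirections_designValue_le)
open Summit.PneNP.PneNP.Theorems.ChebyshevTracialDesignHSymmetricAmplitudeOne (containment_pairSymm)

variable {n : ℕ}

/-- **(CG_1′) FOR `H`-SYMMETRIC MASKS, LITERAL FORM (brick 145p).** For some `a > 0` and all large even `n`: every balanced exact design `(t, C, w)` of degree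
`dq n` on levels `≤ Tq n` with `Σ|w| ≤ 20`, every balanced block `2|H| = n`, every mask `0 ≤ ψ ≤ G` and every direction field `v : PM_n → [n] → [−1,1]`
satisfy `Σ_M (Σ_U W(U,M)·ψ(|U∩H|)·(Σ_p v_M(p)·x_p x_{π_M p})²)₊ ≤ 7·10⁶·G·n⁶·(e^{−a·dq n} + 2^{−⌊n/40⌋})`.
[cite: Rothvoss2017, §2 and Lemma 7 (PDF pp. 5–8)] [cite: KeevashLifshitz2023, Thm. 1.8] [cite: GriblingDelaatLaurent2019, §5] -/
theorem containment_allDirections_decay :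
    ∃ a : ℝ, 0 < a ∧ ∃ n₀ : ℕ, ∀ n : ℕ, n₀ ≤ n → Even n → ∀ {t : ℕ} {C : Finset ℕ} {w : ℕ → ℝ},
    IsBalancedDesign n t (Tq n) (dq n) 20 C w →
    ∀ (H : Finset (Fin n)), 2 * H.card = n →
    ∀ (ψ : ℤ → ℝ) {G : ℝ}, 0 ≤ G → (∀ x, 0 ≤ ψ x) → (∀ x, ψ x ≤ G) →
    ∀ (v : PMatch n → Fin n → ℝ), (∀ M p, |v M p| ≤ 1) →
    ∑ M : PMatch n, max (∑ U : OddSet n, levelWeight n t C w U M *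
        (ψ ((U.1 ∩ H).card : ℤ) *
          (∑ p : Fin n, v M p * ((if p ∈ U.1 then (1 : ℝ) else 0) * (if M.2.partner p ∈ U.1 then (1 : ℝ) else 0))) ^ 2)) 0 ≤
      7 * 10 ^ 6 * G * (n : ℝ) ^ 6 * (Real.exp (-(a * dq n)) + (1 / 2 : ℝ) ^ (n / 40)) := by
  classical
  obtain ⟨a, ha, n₀, h145⟩ := allDirections_designValue_le
  refine ⟨a, ha, n₀, ?_⟩
  intro n hn hev t C w hdes H hH ψ G hG0 hψ0 hψG v hv
  -- the field `c_M := [Q_M(v_M) ≥ 0]·sym(v_M)`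
  obtain ⟨c, hc⟩ : ∃ c : PMatch n → Fin n → ℝ, ∀ M p, c M p =
      if 0 ≤ ∑ U : OddSet n, levelWeight n t C w U M * (ψ ((U.1 ∩ H).card : ℤ) *
          (∑ p : Fin n, v M p * ((if p ∈ U.1 then (1 : ℝ) else 0) * (if M.2.partner p ∈ U.1 then (1 : ℝ) else 0))) ^ 2)
      then (v M p + v M (M.2.partner p)) / 2 else 0 := ⟨_, fun _ _ => rfl⟩
  have hc1 : ∀ M p, |c M p| ≤ 1 := fun M p => by
    rw [hc]
    split_ifs
    · have h1 := abs_le.1 (hv M p); have h2 := abs_le.1 (hv M (M.2.partner p))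
      rw [abs_le]; constructor <;> linarith
    · simp
  have hcπ : ∀ M p, c M (M.2.partner p) = c M p := fun M p => by
    rw [hc, hc, M.2.partner_partner]
    split_ifs <;> ring
  have key := h145 n hn hev hdes H hH ψ hG0 hψ0 hψG c hc1 hcπ
  refine le_trans (le_of_eq (sum_congr rfl fun M _ => ?_)) key
  -- `max (Q_M(v_M)) 0 = Q_M(c_M)`
  by_cases hpos : 0 ≤ ∑ U : OddSet n, levelWeight n t C w U M * (ψ ((U.1 ∩ H).card : ℤ) *
      (∑ p : Fin n, v M p * ((if p ∈ U.1 then (1 : ℝ) else 0) * (if M.2.partner p ∈ U.1 then (1 : ℝ) else 0))) ^ 2)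
  · rw [max_eq_left hpos]
    refine Fintype.sum_congr _ _ fun U => ?_
    rw [containment_pairSymm M U.1 (v M)]
    congr 3
    refine sum_congr rfl fun p _ => ?_
    rw [hc, if_pos hpos]
  · rw [max_eq_right (le_of_lt (lt_of_not_ge hpos))]
    symm
    refine sum_eq_zero fun U _ => ?_
    have : ∑ p : Fin n, c M p * ((if p ∈ U.1 then (1 : ℝ) else 0) * (if M.2.partner p ∈ U.1 then (1 : ℝ) else 0)) = 0 :=
      sum_eq_zero fun p _ => by rw [hc, if_neg hpos, zero_mul]
    rw [this]; ring

end Summit.PneNP.PneNP.Theorems.ChebyshevTracialDesignAllDirectionsPosPart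

end
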